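import Summits.AtomisticToContinuum.HydrodynamicLimit.Theses.TwoClocks
import Summits.AtomisticToContinuum.HydrodynamicLimit.Theorems.TwoClocksEquilibriumClampedCollisionalWindowLDRefutation
import HarnessLib

/-!
# `ClampedEntropyClock` (stmt-AtomisticToContinuum-15145) — closure of the item AS FILED (vacuous)

The crux `KineticWindowLDUniform → EquilibriumClampedCollisionalWindowLD → CollisionActivityTails → EnergyCurrentTails →
DiluteSelfConsistency → HydrodynamicLimit` has the clamped collisional crux `EquilibriumClampedCollisionalWindowLD`
(stmt-AtomisticToContinuum-13733) as its second antecedent. That statement is REFUTED in Lean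
(`Theorems/TwoClocksEquilibriumClampedCollisionalWindowLDRefutation.lean`, refuter cdisprove-13733: Newton-cradle pulse against the
ENERGY conjunct of the momentum-clamped collisional window LD; class refuted-misstated, repair C′ = transfer-activity clamp).
Hence the item as filed and the dock support `ClampedWindowDock` (stmt-13735) are vacuously true (so is the rev-4 frame `Assembly`,
stmt-13805); this file records the ex-falso closures.

VACUOUS — for the wrong reason. The honest content of the clock is the planner's restatement over the repaired collisional node
(`Cruxes/ClampedEntropyClock/Lines/IdeatorTwoSketch_restated.lean`: `ClampedEntropyClockRestated := KineticWindowLDUniform →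
KineticWindowLDUniformBounded → LocalClampedTransferWindowLDUniform → TransferActivityTails → EnergyCurrentTails →
DiluteSelfConsistency → HydrodynamicLimit`, composition kernel-checked from the line's landed glue; its one XL residue
`WindowEntropyStepRestated` is the heart shared with `ClampedCurrentsDock` stmt-14680 / `HydroLimitInBand` stmt-9133 and should be
stated on the family-uniform local nodes of the 14680 line so that ONE heart serves all three). The eleven helpers landed by line
IdeatorTwoSketch (S1–S5, S7a, S7c, S7b-i, R2, CollisionJumpExponent) are restatement-proof and carry over verbatim.

Maintenance record (full-build repair, 2026-08-17; dependency drift, content unchanged). Route TwoClocks rev 10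
(2026-08-16T20:17Z, the repair AFTER and BECAUSE OF the refutation of stmt-13733) restated `ClampedEntropyClock` (stmt-15145 →
`TransferEntropyClock`, stmt-16625), DROPPED `ClampedWindowDock` (stmt-13735) and `CollisionActivityTails` (→ `TransferActivityTails`),
replaced the refuted `EquilibriumClampedCollisionalWindowLD` by `ClampedTransferWindowLD` (stmt-16623) and restated `Assembly` under
the SAME name (stmt-13805 → stmt-16626, no longer vacuous), so all three closures stopped elaborating (33:36, 38:34, 46:56). Repair,
append-only: the two retired statements `ClampedEntropyClock` and `ClampedWindowDock` are RECORDED below under their exact former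
names with their ledger signatures VERBATIM (by name; the constituents are read from the live route declarations, from the
refuted record `TwoClocks.EquilibriumClampedCollisionalWindowLD` of the refutation file, and from the byte-identical
`OneFlightGossipEngine` copy of the dropped `CollisionActivityTails`), so `clampedEntropyClock_proof` / `clampedWindowDock_proof`
keep signature and proof byte-for-byte; the rev-4 frame stmt-13805 is spelled out verbatim as `twoClocksAssemblyRev4_vacuous`
(ex falso, same term) and `twoClocksAssembly_proof`, whose text `Assembly` now denotes the OPEN rev-10 frame stmt-16626, is kept as
its deprecated alias. The import of `TwoClocksAssembly` (its rev-4 vacuity lemma became `assembly_of_not_clampedTransferWindowLD`,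
not applicable ex falso) is dropped. Records, not route items; all three recorded statements are VACUOUSLY TRUE.
-/

namespace Summit.AtomisticToContinuum.HydrodynamicLimit.Theses.TwoClocks

open Summit.AtomisticToContinuum.HydrodynamicLimit.Theses.OneFlightGossipEngine (CollisionActivityTails)

/-- **RECORD of the retired crux `TwoClocks.ClampedEntropyClock`** (stmt-AtomisticToContinuum-15145, closed `proved` by
`Theorems.clampedEntropyClock_proof` @ 4d363ff6c63c; restated at route rev 10 as `TransferEntropyClock`, stmt-16625), under its
former name and with its ledger signature verbatim: the rev-4 macroscopic clock `KineticWindowLDUniform →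
EquilibriumClampedCollisionalWindowLD → CollisionActivityTails → EnergyCurrentTails → DiluteSelfConsistency → HydrodynamicLimit`.
VACUOUS (its second antecedent is the refuted stmt-13733, read from the record in
`TwoClocksEquilibriumClampedCollisionalWindowLDRefutation.lean`; `CollisionActivityTails` is the byte-identical OneFlightGossipEngine
copy of the dropped TwoClocks copy). A record definition, not a route item. -/
def ClampedEntropyClock : Prop :=
  KineticWindowLDUniform → EquilibriumClampedCollisionalWindowLD → CollisionActivityTails → EnergyCurrentTails → DiluteSelfConsistency → _root_.HydrodynamicLimit

/-- **RECORD of the dropped support `TwoClocks.ClampedWindowDock`** (stmt-AtomisticToContinuum-13735, closed `proved` by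
`Theorems.clampedWindowDock_proof` @ 4d363ff6c63c; dropped at route rev 10), under its former name and with its ledger signature
verbatim: `KineticWindowLDUniform → EquilibriumClampedCollisionalWindowLD → CollisionActivityTails → EnergyCurrentTails →
UniformLocalGibbsConcentration → HsEosLowDensity → DiluteSelfConsistency → RelEntropyVanishing`. VACUOUS, same reason and same
readings as `ClampedEntropyClock`. A record definition, not a route item. -/
def ClampedWindowDock : Prop :=
  KineticWindowLDUniform → EquilibriumClampedCollisionalWindowLD → CollisionActivityTails → EnergyCurrentTails → UniformLocalGibbsConcentration → HsEosLowDensity → DiluteSelfConsistency → RelEntropyVanishing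

end Summit.AtomisticToContinuum.HydrodynamicLimit.Theses.TwoClocks

namespace Summit.AtomisticToContinuum.HydrodynamicLimit.Theorems

open Summit.AtomisticToContinuum.HydrodynamicLimit.Theses.TwoClocks
open Summit.AtomisticToContinuum.HydrodynamicLimit.Theses.OneFlightGossipEngine (CollisionActivityTails)

/-- **`ClampedEntropyClock` (stmt-AtomisticToContinuum-15145) as filed, ex falso** from the Lean refutation of its second
antecedent `EquilibriumClampedCollisionalWindowLD` (stmt-13733). VACUOUS: the substantive clock is the planner's restatement
`ClampedEntropyClockRestated` over the repaired collisional node C′ (transfer-activity clamp). [folklore] -/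
theorem clampedEntropyClock_proof : ClampedEntropyClock :=
  fun _ h₃ _ _ _ => absurd h₃ TwoClocksEquilibriumClampedCollisionalWindowLD_refuted

/-- **`ClampedWindowDock` (stmt-AtomisticToContinuum-13735) as filed, ex falso** from the same refutation (its second
antecedent). VACUOUS, same caveat. [folklore] -/
theorem clampedWindowDock_proof : ClampedWindowDock :=
  fun _ h₃ _ _ _ _ _ => absurd h₃ TwoClocksEquilibriumClampedCollisionalWindowLD_refuted

/-- **The rev-4 frame `Assembly` (stmt-AtomisticToContinuum-13805, closed `proved` by `twoClocksAssembly_proof` @ 055f6da789e5),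
spelled out with its ledger signature verbatim, ex falso** from the Lean refutation of its second antecedent
`EquilibriumClampedCollisionalWindowLD` (stmt-13733). VACUOUS, same caveat as above: the honest frame is the rev-10 restatement
over the repaired collisional node C′ (`Theses.TwoClocks.Assembly`, stmt-16626, OPEN — its antecedents are open cruxes and none
is refuted). [folklore] -/
theorem twoClocksAssemblyRev4_vacuous :
    KineticWindowLDUniform → EquilibriumClampedCollisionalWindowLD → EnergyCurrentTails → CollisionActivityTails →
      UniformLocalGibbsConcentration → HsEosLowDensity → DiluteSelfConsistency → _root_.HydrodynamicLimit :=
  fun _ h₃ _ _ _ _ _ => absurd h₃ TwoClocksEquilibriumClampedCollisionalWindowLD_refuted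

/-- Deprecated spelling (landed p124396 as `twoClocksAssembly_proof : Assembly`, the rev-4 frame stmt-13805, through the then
vacuity lemma `assembly_of_not_equilibriumClampedCollisionalWindowLD`). Since route rev 10 (2026-08-16T20:17Z) the decl `Assembly`
denotes the restated OPEN frame stmt-16626 (`… → ClampedTransferWindowLD → … → TransferActivityTails → …`), which is not
vacuous, so the text no longer elaborates nor says what it said; the name is kept (append-only) as an alias of the verbatim
rev-4 statement `twoClocksAssemblyRev4_vacuous`. [folklore] -/
@[deprecated twoClocksAssemblyRev4_vacuous (since := "2026-08-17")]
alias twoClocksAssembly_proof := twoClocksAssemblyRev4_vacuous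

end Summit.AtomisticToContinuum.HydrodynamicLimit.Theorems
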